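import Mathlib
import HarnessLib
import Summits.NavierStokesRegularity.NavierStokesRegularity.Theorems.CompletionRelayChainDefs
import Summits.NavierStokesRegularity.NavierStokesRegularity.Theorems.CompletionRelayChainPhaseIBlockField
import Literature.Analysis.FluidPDE.Tao2016AveragedNS.RestartedCascadeFlows

/-!
# Route `CompletionRelayChain` — crux `RelayFrontStep` (stmt-NavierStokesRegularity-24850), LINE `window_v2`:
  K-side of `stub_phaseI`, work package K2 (b) — EXTRACTION OF THE BLOCK ODE FROM THE ROWS

Sequel of `…PhaseIBlockField.lean` (`BIdx`, `lam`, `relayQ` and its 18 row lemmas).  Here: `blockMode`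
(`x,u,r ↦ 0,1,2 ∈ Fin 4`), `blockState S t : BIdx → ℝ` (the 18 block amplitudes `S i (s−3) t` of a flow at time
`t`), `blockForcing S t` (the four products of `RelayRows` with a factor on the outer shells `−4` / `3`), and
**`quadTerm_block`**: under `RelayRows α`, for every block index `(s,i)`,
`quadTerm 1 α S i (s − 3) t = relayQ (blockState S t) (blockState S t) (s,i) + blockForcing S t (s,i)`
(18 case lemmas `quadTerm_block_s_i`, then the packaged statement); and the BLOCK CURVE of a restarted
pseudo-flow (`PseudoFlowOn τ 1 α κ₁ κ₂ S₀ F₀ B₀ S F`): `blockVel` (within-`[0,τ]` derivatives),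
`hasDerivWithinAt_blockState`, `blockVel_sub_field_le` (`|z' − relayQ z z − blockForcing|_c ≤ κ₁4^k√F_{i,k}` from
`PseudoFlowOn.motion`), `hasDerivWithinAt_translate` and `blockStep` (the curve on a step `[a, a+h]` translated to
`[0,h]`, the shape `…PhaseIPseudoStep` consumes) — the starting point of `phaseI_of_check` (K5).

Definitions + algebra only; MODEL-lattice bookkeeping (rung TL-M3-R64); nothing here is a statement about the
Navier–Stokes equations; the crux is OPEN.
-/

noncomputable section

-- the summit-side namespace repeats a component by design (single-conjunct summit, D-0017)
set_option linter.dupNamespace false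

open Literature.Analysis.FluidPDE.TaoCascade

namespace Summit.NavierStokesRegularity.NavierStokesRegularity.Cruxes.RelayFrontStep.PhaseI

open Set

/-! ### Extraction of the block ODE from the rows -/

/-- `Λ_n` in the literal shape of the rows. [this file] -/
theorem lam_eq (n : ℤ) : (1 + 1 : ℝ) ^ ((5 : ℝ) * (n : ℝ) / 2) = lam n := rfl

/-- `Λ_{n−1}` in the literal shape of the rows. [this file] -/
theorem lam_eq_sub (n : ℤ) : (1 + 1 : ℝ) ^ ((5 : ℝ) * ((n : ℝ) - 1) / 2) = lam (n - 1) := by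
  simp [lam, Int.cast_sub]

/-- The active modes `x,u,r ∈ Fin 3` as modes of the 4-mode table. [this file] -/
def blockMode : Fin 3 → Fin 4 := ![0, 1, 2]

/-- The block amplitudes of a flow `S` at time `t` as a vector: slot `s` ↦ pseudo-flow shell `s − 3`. [this file] -/
def blockState (S : Fin 4 → ℤ → ℝ → ℝ) (t : ℝ) : BIdx → ℝ :=
  fun c => S (blockMode c.2) (((c.1 : ℕ) : ℤ) - 3) t

/-- The FORCING of the block by the outer shells `−4` and `3`: the four products of `RelayRows` with a factor
off the block (`Λ₋₄u₋₄²` into `ẋ₋₃`, `(Λ₋₄/32) r₋₄u₋₄` into `u̇₋₃`, `−Λ₂u₂x₃ − (Λ₂/32)x₃r₂` into `u̇₂`,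
`(Λ₂/32)(x₃u₂ − u₂u₃)` into `ṙ₂`); zero elsewhere. [this file] -/
def blockForcing (S : Fin 4 → ℤ → ℝ → ℝ) (t : ℝ) : BIdx → ℝ := fun c =>
  if c = ((0 : Fin 6), (0 : Fin 3)) then lam (-4) * (S 1 (-4) t * S 1 (-4) t)
  else if c = ((0 : Fin 6), (1 : Fin 3)) then lam (-4) / 32 * (S 2 (-4) t * S 1 (-4) t)
  else if c = ((5 : Fin 6), (1 : Fin 3)) then
    -(lam 2 * (S 1 2 t * S 0 3 t)) - lam 2 / 32 * (S 0 3 t * S 2 2 t)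
  else if c = ((5 : Fin 6), (2 : Fin 3)) then lam 2 / 32 * (S 0 3 t * S 1 2 t - S 1 2 t * S 1 3 t)
  else 0

/-- `quadTerm_block`, slot `0` (shell `-3`), row `x`. [this file] -/
theorem quadTerm_block_0_0 {α : Fin 4 → Fin 4 → Fin 4 → ℤ × ℤ × ℤ → ℝ} (hR : Window2.RelayRows α)
    (S : Fin 4 → ℤ → ℝ → ℝ) (t : ℝ) :
    quadTerm 1 α S 0 (-3) t =
      relayQ (blockState S t) (blockState S t) ((0 : Fin 6), (0 : Fin 3)) +
        blockForcing S t ((0 : Fin 6), (0 : Fin 3)) := by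
  rw [hR.1 S (-3) t, relayQ_apply_0_0]
  simp only [lam_eq, lam_eq_sub]
  simp [blockState, blockMode, blockForcing]

/-- `quadTerm_block`, slot `0` (shell `-3`), row `u`. [this file] -/
theorem quadTerm_block_0_1 {α : Fin 4 → Fin 4 → Fin 4 → ℤ × ℤ × ℤ → ℝ} (hR : Window2.RelayRows α)
    (S : Fin 4 → ℤ → ℝ → ℝ) (t : ℝ) :
    quadTerm 1 α S 1 (-3) t =
      relayQ (blockState S t) (blockState S t) ((0 : Fin 6), (1 : Fin 3)) +
        blockForcing S t ((0 : Fin 6), (1 : Fin 3)) := by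
  rw [hR.2.1 S (-3) t, relayQ_apply_0_1]
  simp only [lam_eq, lam_eq_sub]
  simp [blockState, blockMode, blockForcing]
  norm_num
  ring

/-- `quadTerm_block`, slot `0` (shell `-3`), row `r`. [this file] -/
theorem quadTerm_block_0_2 {α : Fin 4 → Fin 4 → Fin 4 → ℤ × ℤ × ℤ → ℝ} (hR : Window2.RelayRows α)
    (S : Fin 4 → ℤ → ℝ → ℝ) (t : ℝ) :
    quadTerm 1 α S 2 (-3) t =
      relayQ (blockState S t) (blockState S t) ((0 : Fin 6), (2 : Fin 3)) +
        blockForcing S t ((0 : Fin 6), (2 : Fin 3)) := by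
  rw [hR.2.2.1 S (-3) t, relayQ_apply_0_2]
  simp only [lam_eq]
  simp [blockState, blockMode, blockForcing]
  norm_num
  ring

/-- `quadTerm_block`, slot `1` (shell `-2`), row `x`. [this file] -/
theorem quadTerm_block_1_0 {α : Fin 4 → Fin 4 → Fin 4 → ℤ × ℤ × ℤ → ℝ} (hR : Window2.RelayRows α)
    (S : Fin 4 → ℤ → ℝ → ℝ) (t : ℝ) :
    quadTerm 1 α S 0 (-2) t =
      relayQ (blockState S t) (blockState S t) ((1 : Fin 6), (0 : Fin 3)) +
        blockForcing S t ((1 : Fin 6), (0 : Fin 3)) := by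
  rw [hR.1 S (-2) t, relayQ_apply_1_0]
  simp only [lam_eq, lam_eq_sub]
  simp [blockState, blockMode, blockForcing]

/-- `quadTerm_block`, slot `1` (shell `-2`), row `u`. [this file] -/
theorem quadTerm_block_1_1 {α : Fin 4 → Fin 4 → Fin 4 → ℤ × ℤ × ℤ → ℝ} (hR : Window2.RelayRows α)
    (S : Fin 4 → ℤ → ℝ → ℝ) (t : ℝ) :
    quadTerm 1 α S 1 (-2) t =
      relayQ (blockState S t) (blockState S t) ((1 : Fin 6), (1 : Fin 3)) +
        blockForcing S t ((1 : Fin 6), (1 : Fin 3)) := by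
  rw [hR.2.1 S (-2) t, relayQ_apply_1_1]
  simp only [lam_eq, lam_eq_sub]
  simp [blockState, blockMode, blockForcing]
  norm_num
  ring

/-- `quadTerm_block`, slot `1` (shell `-2`), row `r`. [this file] -/
theorem quadTerm_block_1_2 {α : Fin 4 → Fin 4 → Fin 4 → ℤ × ℤ × ℤ → ℝ} (hR : Window2.RelayRows α)
    (S : Fin 4 → ℤ → ℝ → ℝ) (t : ℝ) :
    quadTerm 1 α S 2 (-2) t =
      relayQ (blockState S t) (blockState S t) ((1 : Fin 6), (2 : Fin 3)) +
        blockForcing S t ((1 : Fin 6), (2 : Fin 3)) := by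
  rw [hR.2.2.1 S (-2) t, relayQ_apply_1_2]
  simp only [lam_eq]
  simp [blockState, blockMode, blockForcing]
  norm_num
  ring

/-- `quadTerm_block`, slot `2` (shell `-1`), row `x`. [this file] -/
theorem quadTerm_block_2_0 {α : Fin 4 → Fin 4 → Fin 4 → ℤ × ℤ × ℤ → ℝ} (hR : Window2.RelayRows α)
    (S : Fin 4 → ℤ → ℝ → ℝ) (t : ℝ) :
    quadTerm 1 α S 0 (-1) t =
      relayQ (blockState S t) (blockState S t) ((2 : Fin 6), (0 : Fin 3)) +
        blockForcing S t ((2 : Fin 6), (0 : Fin 3)) := by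
  rw [hR.1 S (-1) t, relayQ_apply_2_0]
  simp only [lam_eq, lam_eq_sub]
  simp [blockState, blockMode, blockForcing]

/-- `quadTerm_block`, slot `2` (shell `-1`), row `u`. [this file] -/
theorem quadTerm_block_2_1 {α : Fin 4 → Fin 4 → Fin 4 → ℤ × ℤ × ℤ → ℝ} (hR : Window2.RelayRows α)
    (S : Fin 4 → ℤ → ℝ → ℝ) (t : ℝ) :
    quadTerm 1 α S 1 (-1) t =
      relayQ (blockState S t) (blockState S t) ((2 : Fin 6), (1 : Fin 3)) +
        blockForcing S t ((2 : Fin 6), (1 : Fin 3)) := by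
  rw [hR.2.1 S (-1) t, relayQ_apply_2_1]
  simp only [lam_eq, lam_eq_sub]
  simp [blockState, blockMode, blockForcing]
  norm_num
  ring

/-- `quadTerm_block`, slot `2` (shell `-1`), row `r`. [this file] -/
theorem quadTerm_block_2_2 {α : Fin 4 → Fin 4 → Fin 4 → ℤ × ℤ × ℤ → ℝ} (hR : Window2.RelayRows α)
    (S : Fin 4 → ℤ → ℝ → ℝ) (t : ℝ) :
    quadTerm 1 α S 2 (-1) t =
      relayQ (blockState S t) (blockState S t) ((2 : Fin 6), (2 : Fin 3)) +
        blockForcing S t ((2 : Fin 6), (2 : Fin 3)) := by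
  rw [hR.2.2.1 S (-1) t, relayQ_apply_2_2]
  simp only [lam_eq]
  simp [blockState, blockMode, blockForcing]
  norm_num
  ring

/-- `quadTerm_block`, slot `3` (shell `0`), row `x`. [this file] -/
theorem quadTerm_block_3_0 {α : Fin 4 → Fin 4 → Fin 4 → ℤ × ℤ × ℤ → ℝ} (hR : Window2.RelayRows α)
    (S : Fin 4 → ℤ → ℝ → ℝ) (t : ℝ) :
    quadTerm 1 α S 0 0 t =
      relayQ (blockState S t) (blockState S t) ((3 : Fin 6), (0 : Fin 3)) +
        blockForcing S t ((3 : Fin 6), (0 : Fin 3)) := by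
  rw [hR.1 S 0 t, relayQ_apply_3_0]
  simp only [lam_eq, lam_eq_sub]
  simp [blockState, blockMode, blockForcing]

/-- `quadTerm_block`, slot `3` (shell `0`), row `u`. [this file] -/
theorem quadTerm_block_3_1 {α : Fin 4 → Fin 4 → Fin 4 → ℤ × ℤ × ℤ → ℝ} (hR : Window2.RelayRows α)
    (S : Fin 4 → ℤ → ℝ → ℝ) (t : ℝ) :
    quadTerm 1 α S 1 0 t =
      relayQ (blockState S t) (blockState S t) ((3 : Fin 6), (1 : Fin 3)) +
        blockForcing S t ((3 : Fin 6), (1 : Fin 3)) := by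
  rw [hR.2.1 S 0 t, relayQ_apply_3_1]
  simp only [lam_eq, lam_eq_sub]
  simp [blockState, blockMode, blockForcing]
  norm_num
  ring

/-- `quadTerm_block`, slot `3` (shell `0`), row `r`. [this file] -/
theorem quadTerm_block_3_2 {α : Fin 4 → Fin 4 → Fin 4 → ℤ × ℤ × ℤ → ℝ} (hR : Window2.RelayRows α)
    (S : Fin 4 → ℤ → ℝ → ℝ) (t : ℝ) :
    quadTerm 1 α S 2 0 t =
      relayQ (blockState S t) (blockState S t) ((3 : Fin 6), (2 : Fin 3)) +
        blockForcing S t ((3 : Fin 6), (2 : Fin 3)) := by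
  rw [hR.2.2.1 S 0 t, relayQ_apply_3_2]
  simp only [lam_eq]
  simp [blockState, blockMode, blockForcing]
  norm_num
  ring

/-- `quadTerm_block`, slot `4` (shell `1`), row `x`. [this file] -/
theorem quadTerm_block_4_0 {α : Fin 4 → Fin 4 → Fin 4 → ℤ × ℤ × ℤ → ℝ} (hR : Window2.RelayRows α)
    (S : Fin 4 → ℤ → ℝ → ℝ) (t : ℝ) :
    quadTerm 1 α S 0 1 t =
      relayQ (blockState S t) (blockState S t) ((4 : Fin 6), (0 : Fin 3)) +
        blockForcing S t ((4 : Fin 6), (0 : Fin 3)) := by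
  rw [hR.1 S 1 t, relayQ_apply_4_0]
  simp only [lam_eq, lam_eq_sub]
  simp [blockState, blockMode, blockForcing]

/-- `quadTerm_block`, slot `4` (shell `1`), row `u`. [this file] -/
theorem quadTerm_block_4_1 {α : Fin 4 → Fin 4 → Fin 4 → ℤ × ℤ × ℤ → ℝ} (hR : Window2.RelayRows α)
    (S : Fin 4 → ℤ → ℝ → ℝ) (t : ℝ) :
    quadTerm 1 α S 1 1 t =
      relayQ (blockState S t) (blockState S t) ((4 : Fin 6), (1 : Fin 3)) +
        blockForcing S t ((4 : Fin 6), (1 : Fin 3)) := by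
  rw [hR.2.1 S 1 t, relayQ_apply_4_1]
  simp only [lam_eq, lam_eq_sub]
  simp [blockState, blockMode, blockForcing]
  norm_num
  ring

/-- `quadTerm_block`, slot `4` (shell `1`), row `r`. [this file] -/
theorem quadTerm_block_4_2 {α : Fin 4 → Fin 4 → Fin 4 → ℤ × ℤ × ℤ → ℝ} (hR : Window2.RelayRows α)
    (S : Fin 4 → ℤ → ℝ → ℝ) (t : ℝ) :
    quadTerm 1 α S 2 1 t =
      relayQ (blockState S t) (blockState S t) ((4 : Fin 6), (2 : Fin 3)) +
        blockForcing S t ((4 : Fin 6), (2 : Fin 3)) := by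
  rw [hR.2.2.1 S 1 t, relayQ_apply_4_2]
  simp only [lam_eq]
  simp [blockState, blockMode, blockForcing]
  norm_num
  ring

/-- `quadTerm_block`, slot `5` (shell `2`), row `x`. [this file] -/
theorem quadTerm_block_5_0 {α : Fin 4 → Fin 4 → Fin 4 → ℤ × ℤ × ℤ → ℝ} (hR : Window2.RelayRows α)
    (S : Fin 4 → ℤ → ℝ → ℝ) (t : ℝ) :
    quadTerm 1 α S 0 2 t =
      relayQ (blockState S t) (blockState S t) ((5 : Fin 6), (0 : Fin 3)) +
        blockForcing S t ((5 : Fin 6), (0 : Fin 3)) := by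
  rw [hR.1 S 2 t, relayQ_apply_5_0]
  simp only [lam_eq, lam_eq_sub]
  simp [blockState, blockMode, blockForcing]

/-- `quadTerm_block`, slot `5` (shell `2`), row `u`. [this file] -/
theorem quadTerm_block_5_1 {α : Fin 4 → Fin 4 → Fin 4 → ℤ × ℤ × ℤ → ℝ} (hR : Window2.RelayRows α)
    (S : Fin 4 → ℤ → ℝ → ℝ) (t : ℝ) :
    quadTerm 1 α S 1 2 t =
      relayQ (blockState S t) (blockState S t) ((5 : Fin 6), (1 : Fin 3)) +
        blockForcing S t ((5 : Fin 6), (1 : Fin 3)) := by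
  rw [hR.2.1 S 2 t, relayQ_apply_5_1]
  simp only [lam_eq, lam_eq_sub]
  simp [blockState, blockMode, blockForcing]
  norm_num
  ring

/-- `quadTerm_block`, slot `5` (shell `2`), row `r`. [this file] -/
theorem quadTerm_block_5_2 {α : Fin 4 → Fin 4 → Fin 4 → ℤ × ℤ × ℤ → ℝ} (hR : Window2.RelayRows α)
    (S : Fin 4 → ℤ → ℝ → ℝ) (t : ℝ) :
    quadTerm 1 α S 2 2 t =
      relayQ (blockState S t) (blockState S t) ((5 : Fin 6), (2 : Fin 3)) +
        blockForcing S t ((5 : Fin 6), (2 : Fin 3)) := by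
  rw [hR.2.2.1 S 2 t, relayQ_apply_5_2]
  simp only [lam_eq]
  simp [blockForcing]
  norm_num
  ring

/-- **EXTRACTION OF THE BLOCK ODE FROM THE ROWS**: under `RelayRows α`, for every block index `(s, i)`,
`quadTerm 1 α S i (s − 3) t = relayQ (blockState S t) (blockState S t) (s, i) + blockForcing S t (s, i)`.
[this file] -/
theorem quadTerm_block {α : Fin 4 → Fin 4 → Fin 4 → ℤ × ℤ × ℤ → ℝ} (hR : Window2.RelayRows α)
    (S : Fin 4 → ℤ → ℝ → ℝ) (t : ℝ) (c : BIdx) :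
    quadTerm 1 α S (blockMode c.2) (((c.1 : ℕ) : ℤ) - 3) t =
      relayQ (blockState S t) (blockState S t) c + blockForcing S t c := by
  obtain ⟨s, i⟩ := c
  fin_cases s <;> fin_cases i
  · norm_num [blockMode]
    exact quadTerm_block_0_0 hR S t
  · norm_num [blockMode]
    exact quadTerm_block_0_1 hR S t
  · norm_num [blockMode]
    exact quadTerm_block_0_2 hR S t
  · norm_num [blockMode]
    exact quadTerm_block_1_0 hR S t
  · norm_num [blockMode]
    exact quadTerm_block_1_1 hR S t
  · norm_num [blockMode]
    exact quadTerm_block_1_2 hR S t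
  · norm_num [blockMode]
    exact quadTerm_block_2_0 hR S t
  · norm_num [blockMode]
    exact quadTerm_block_2_1 hR S t
  · norm_num [blockMode]
    exact quadTerm_block_2_2 hR S t
  · norm_num [blockMode]
    exact quadTerm_block_3_0 hR S t
  · norm_num [blockMode]
    exact quadTerm_block_3_1 hR S t
  · norm_num [blockMode]
    exact quadTerm_block_3_2 hR S t
  · norm_num [blockMode]
    exact quadTerm_block_4_0 hR S t
  · norm_num [blockMode]
    exact quadTerm_block_4_1 hR S t
  · norm_num [blockMode]
    exact quadTerm_block_4_2 hR S t
  · norm_num [blockMode]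
    exact quadTerm_block_5_0 hR S t
  · norm_num [blockMode]
    exact quadTerm_block_5_1 hR S t
  · norm_num [blockMode]
    exact quadTerm_block_5_2 hR S t

/-! ### The block curve of a pseudo-flow -/

/-- Translation of a one-sided derivative: `σ ↦ z (a + σ)` on `[0,h] ⊆ [0,τ] − a`. [folklore] -/
theorem hasDerivWithinAt_translate {E : Type*} [NormedAddCommGroup E] [NormedSpace ℝ E]
    {z : ℝ → E} {z' : E} {τ a h σ : ℝ} (ha : 0 ≤ a) (hah : a + h ≤ τ)
    (hz : HasDerivWithinAt z z' (Icc 0 τ) (a + σ)) :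
    HasDerivWithinAt (fun s => z (a + s)) z' (Icc 0 h) σ := by
  have hin : HasDerivWithinAt (fun s : ℝ => a + s) 1 (Icc 0 h) σ :=
    (hasDerivWithinAt_id σ _).const_add a
  have hmaps : MapsTo (fun s : ℝ => a + s) (Icc 0 h) (Icc 0 τ) :=
    fun s hs => ⟨by linarith [hs.1], by linarith [hs.2]⟩
  have key := hz.scomp σ hin hmaps
  simpa only [Function.comp_def, one_smul] using key

/-- The VELOCITY of the block curve: the within-`[0,τ]` derivatives of the 18 block amplitudes. [this file] -/
def blockVel (S : Fin 4 → ℤ → ℝ → ℝ) (τ t : ℝ) : BIdx → ℝ :=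
  fun c => derivWithin (S (blockMode c.2) (((c.1 : ℕ) : ℤ) - 3)) (Icc 0 τ) t

/-- The block curve `t ↦ blockState S t` of a restarted pseudo-flow is differentiable within `[0,τ]` with
velocity `blockVel` (from `PseudoFlowOn.contDiffOn_S`). [this file] -/
theorem hasDerivWithinAt_blockState {τ : ℝ} {α : Fin 4 → Fin 4 → Fin 4 → ℤ × ℤ × ℤ → ℝ} {κ₁ κ₂ : ℝ}
    {S₀ F₀ B₀ : Fin 4 → ℤ → ℝ} {S F : Fin 4 → ℤ → ℝ → ℝ}
    (hP : PseudoFlowOn τ 1 α κ₁ κ₂ S₀ F₀ B₀ S F) :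
    ∀ t ∈ Icc (0:ℝ) τ, HasDerivWithinAt (fun s => blockState S s) (blockVel S τ t) (Icc 0 τ) t := by
  intro t ht
  refine hasDerivWithinAt_pi.2 fun c => ?_
  have hd : DifferentiableOn ℝ (S (blockMode c.2) (((c.1 : ℕ) : ℤ) - 3)) (Icc 0 τ) :=
    (hP.contDiffOn_S _ _).differentiableOn (by norm_num)
  exact (hd t ht).hasDerivWithinAt

/-- **THE BLOCK ODE WITH DEFECT**: along a restarted pseudo-flow with the completion-relay rows,
`|blockVel − relayQ(blockState, blockState) − blockForcing|_c ≤ κ₁ · 4^k · √F_{i,k}` for every block index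
`c = (k+3, i)` and every `t ∈ [0,τ]` (`PseudoFlowOn.motion` + `quadTerm_block`). [this file] -/
theorem blockVel_sub_field_le {τ : ℝ} {α : Fin 4 → Fin 4 → Fin 4 → ℤ × ℤ × ℤ → ℝ} {κ₁ κ₂ : ℝ}
    {S₀ F₀ B₀ : Fin 4 → ℤ → ℝ} {S F : Fin 4 → ℤ → ℝ → ℝ}
    (hP : PseudoFlowOn τ 1 α κ₁ κ₂ S₀ F₀ B₀ S F) (hR : Window2.RelayRows α) :
    ∀ t ∈ Icc (0:ℝ) τ, ∀ c : BIdx,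
      |blockVel S τ t c - relayQ (blockState S t) (blockState S t) c - blockForcing S t c| ≤
        κ₁ * (1 + 1 : ℝ) ^ ((2 : ℝ) * ((((c.1 : ℕ) : ℤ) - 3 : ℤ) : ℝ)) *
          Real.sqrt (F (blockMode c.2) (((c.1 : ℕ) : ℤ) - 3) t) := by
  intro t ht c
  have hm := hP.motion (blockMode c.2) (((c.1 : ℕ) : ℤ) - 3) t ht
  rw [quadTerm_block hR S t c] at hm
  simpa only [blockVel, sub_sub] using hm

/-- **The block curve on one step** `[a, a+h] ⊆ [0,τ]`, translated to `[0,h]` (the shape `…PhaseIPseudoStep`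
consumes): `z σ := blockState S (a+σ)` has velocity `blockVel S τ (a+σ)` within `[0,h]`, and its defect against
`relayQ z z + blockForcing` is `≤ κ₁ 4^k √F_{i,k}(a+σ)` componentwise. [this file] -/
theorem blockStep {τ : ℝ} {α : Fin 4 → Fin 4 → Fin 4 → ℤ × ℤ × ℤ → ℝ} {κ₁ κ₂ : ℝ}
    {S₀ F₀ B₀ : Fin 4 → ℤ → ℝ} {S F : Fin 4 → ℤ → ℝ → ℝ}
    (hP : PseudoFlowOn τ 1 α κ₁ κ₂ S₀ F₀ B₀ S F) (hR : Window2.RelayRows α)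
    {a h : ℝ} (ha : 0 ≤ a) (hah : a + h ≤ τ) :
    (∀ σ ∈ Icc (0:ℝ) h, HasDerivWithinAt (fun s => blockState S (a + s)) (blockVel S τ (a + σ)) (Icc 0 h) σ) ∧
    (∀ σ ∈ Icc (0:ℝ) h, ∀ c : BIdx,
      |blockVel S τ (a + σ) c - relayQ (blockState S (a + σ)) (blockState S (a + σ)) c
          - blockForcing S (a + σ) c| ≤
        κ₁ * (1 + 1 : ℝ) ^ ((2 : ℝ) * ((((c.1 : ℕ) : ℤ) - 3 : ℤ) : ℝ)) *
          Real.sqrt (F (blockMode c.2) (((c.1 : ℕ) : ℤ) - 3) (a + σ))) := by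
  have hmem : ∀ σ ∈ Icc (0:ℝ) h, a + σ ∈ Icc (0:ℝ) τ :=
    fun σ hσ => ⟨by linarith [hσ.1], by linarith [hσ.2]⟩
  refine ⟨fun σ hσ => ?_, fun σ hσ c => blockVel_sub_field_le hP hR (a + σ) (hmem σ hσ) c⟩
  exact hasDerivWithinAt_translate ha hah (hasDerivWithinAt_blockState hP (a + σ) (hmem σ hσ))

end Summit.NavierStokesRegularity.NavierStokesRegularity.Cruxes.RelayFrontStep.PhaseI

end
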